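import Literature.NumberTheory.Sieve.MaynardNFS2Err
import Literature.NumberTheory.Sieve.MaynardK105
import Literature.NumberTheory.Sieve.MaynardTaoL2Reduction
import Literature.NumberTheory.Sieve.BoundedGapsNumberFields
import HarnessLib

/-!
# Bounded gaps in totally real fields: the assembly of Theorem 1.1 from Proposition 2.1, Theorem 2.7 and `M₁₀₅ > 4`

Topic `Literature/NumberTheory/Sieve`. A. Castillo, C. Hall, R. J. Lemke Oliver, P. Pollack,
L. Thompson, *Bounded gaps between primes in number fields and function fields*, Proc. AMS 143 (2015)
= arXiv:1403.5808, §3.1: "Suppose now that `K` is totally real. By Theorem 2.7, the primes in `K`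
have level of distribution `θ` for any `θ < 1/2`. Maynard has shown that the number `M₁₀₅` in
Corollary 2.6 satisfies `M₁₀₅ > 4`. Corollary 1.2 follows now from Corollary 2.6 …". This file
PROVES the assembly of the statement of the named fact
`Literature.NumberTheory.Sieve.castilloEtAl2015_thm_1_1_totallyReal` for a totally real `K` from:

* the two asymptotic statements of Proposition 2.1 (`MaynardNF.S1Asymptotic`,
  `MaynardNF.S2Asymptotic`, for `C¹` test functions cut off to the simplex and all admissible data),
  hypotheses of `twoPrimes_infinite_of_asymptotics` and PROVED in `MaynardNFS1.S1_asymptotic`,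
  `MaynardNFS2Err.S2_asymptotic` (Lemmas 2.2–2.5 and Maynard's Lemmas 5.1–6.3 over `𝓞_K`);
* Theorem 2.7 (Hinz): `MaynardNF.PrimesHaveLevel K θ` for every `0 < θ < 1/2` — HYPOTHESIS;
* the prime number theorem for `P(N)` (Mitsui 1956 + Hinz 1981, p. 11): `MaynardNF.PrimesAsymptotic K`
  — HYPOTHESIS;
* `M₁₀₅ > 4` — the tree's `exists_four_lt_maynardFunctional_holds` (Maynard, Prop. 4.3), moved to a
  polynomial test function by `MaynardL2.exists_polynomial_maynardFunctional_gt`;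
* the `W`-trick class `v₀` (`CastilloEtAl2015.exists_wTrick_class`), Corollary 2.6
  (`MaynardNF.infinite_setOf_lt_card_of_asymptotics`), `Δ = 1`
  (`MaynardNF.tendsto_delta_of_primesAsymptotic`) and the reduction `k ≥ 105 ⟸ k = 105`
  (`CastilloEtAl2015.infinite_of_forall_card_eq`).

Main results: `exists_wTrick_fun`, `exists_theta_delta`,
`twoPrimes_infinite_of_asymptotics` (the conclusion of Theorem 1.1 for `K`, `m = 2`, `k ≥ 105`, from
the two asymptotics), and **`castillo_of_hinz_mitsui`**:
`(∀ K totally real, (∀ θ, 0 < θ < 1/2 → PrimesHaveLevel K θ) ∧ PrimesAsymptotic K) →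
castilloEtAl2015_thm_1_1_totallyReal` — the named fact of `BoundedGapsNumberFields.lean` reduced to
exactly the two external theorems the paper cites (Hinz 1988; Mitsui 1956/Hinz 1981).

## References

* Castillo–Hall–Lemke Oliver–Pollack–Thompson, arXiv:1403.5808, Proposition 2.1, Corollary 2.6,
  Theorem 2.7, §3.1. [CastilloEtAl2015]
* J. Maynard, *Small gaps between primes*, Ann. of Math. 181 (2015), Prop. 4.3 (`M₁₀₅ > 4`).
  [MaynardAnnals2015]
-/

noncomputable section

open Finset Filter Topology Asymptotics NumberField IsDedekindDomain
open scoped NumberField Classical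

namespace Literature.NumberTheory.Sieve.MaynardNF

open Literature.NumberTheory.LFunctions Literature.NumberTheory.LFunctions.NumberField

variable {K : Type*} [Field K] [NumberField K]
variable {k : ℕ}

/-! ### The `W`-trick classes `v₀(N)` -/

/-- For an admissible `H` and shifts `h` with values in `H` there are classes `v₀(N)` with
`(v₀(N) + hᵢ) + 𝔴(N) = (1)` for all `N`, `i` ("`v₀` is a residue class modulo `𝔴` chosen so that
each `α + hᵢ` lies in `(A/𝔴)ˣ`"). [cite: CastilloEtAl2015, §2.2 (choice of v₀)] -/
theorem exists_wTrick_fun {H : Finset (𝓞 K)}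
    (hH : ∀ P : Ideal (𝓞 K), P.IsPrime → ∃ a : 𝓞 K, ∀ h ∈ H, a - h ∉ P)
    {h : Fin k → 𝓞 K} (hh : ∀ i, h i ∈ H) :
    ∃ v₀ : ℝ → 𝓞 K, ∀ N i, Ideal.span {v₀ N + h i} ⊔ paramW K N = ⊤ := by
  have hex : ∀ N : ℝ, ∃ v : 𝓞 K, ∀ i, Ideal.span {v + h i} ⊔ paramW K N = ⊤ := by
    intro N
    obtain ⟨v, hv⟩ := CastilloEtAl2015.exists_wTrick_class H hH (paramW_ne_bot (K := K) N)
    refine ⟨v, fun i => ?_⟩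
    by_contra hne
    obtain ⟨P, hPmax, hle⟩ := Ideal.exists_le_maximal _ hne
    have hP := hPmax.isPrime
    have h𝔴 : paramW K N ≤ P := le_trans le_sup_right hle
    have hmem : v + h i ∈ P := hle (Ideal.mem_sup_left (Ideal.mem_span_singleton_self _))
    exact hv P hP (Ideal.dvd_iff_le.2 h𝔴) v (by simp) (h i) (hh i) hmem
  choose v hv using hex
  exact ⟨v, hv⟩

/-! ### The numerology: `θ < 1/2`, `δ > 0` with `(θ/2 − δ) M > 1` when `M > 4` -/

/-- If `M > 4` there are `0 < θ < 1/2` and `δ > 0` with `θ/2 − δ > 0` and `(θ/2 − δ) M > 1`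
(the totally real numerology of Remark 1 / §3.1: any `θ < 1/2` and `M₁₀₅ > 4` give `r₁₀₅ ≥ 2`).
[cite: CastilloEtAl2015, §3.1 and Remark 1 after Theorem 1.1] -/
theorem exists_theta_delta {M : ℝ} (hM : 4 < M) :
    ∃ θ δ : ℝ, 0 < θ ∧ θ < 1 / 2 ∧ 0 < δ ∧ 0 < θ / 2 - δ ∧ 1 < (θ / 2 - δ) * M := by
  have hM0 : 0 < M := by linarith
  set δ : ℝ := (1 / 4 - 1 / M) / 4 with hδ
  have hgap : 0 < 1 / 4 - 1 / M := by
    rw [sub_pos, one_div_lt_one_div hM0 (by norm_num)]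
    exact hM
  have hδ0 : 0 < δ := by rw [hδ]; positivity
  have hδs : δ < 1 / 16 := by
    rw [hδ]
    have : 1 / 4 - 1 / M < 1 / 4 := by have := one_div_pos.2 hM0; linarith
    linarith
  refine ⟨1 / 2 - 2 * δ, δ, by linarith, by linarith, hδ0, by linarith, ?_⟩
  have h1 : (1 / 2 - 2 * δ) / 2 - δ = 1 / 4 - 2 * δ := by ring
  rw [h1]
  have h2 : 1 / M < 1 / 4 - 2 * δ := by rw [hδ]; linarith
  have h3 : 1 / M * M = 1 := by field_simp
  nlinarith

/-! ### The assembly -/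

/-- **Theorem 1.1 for totally real `K` (`m = 2`, `k₀ = 105`), assembled** from the two statements of
Proposition 2.1 (hypotheses `hS1`, `hS2`, for all admissible data), Theorem 2.7 (Hinz; hypothesis
`hlevel`), the prime number theorem for `P(N)` (Mitsui–Hinz; hypothesis `hP`), and `M₁₀₅ > 4`
(the tree's `exists_four_lt_maynardFunctional_holds`): every admissible `H ⊆ 𝓞_K` with `|H| ≥ 105`
has infinitely many translates containing two primes. This is the exact conclusion of the named fact
`castilloEtAl2015_thm_1_1_totallyReal` at `K`. [cite: CastilloEtAl2015, Theorem 1.1, Corollary 2.6, Theorem 2.7 and §3.1] -/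
theorem twoPrimes_infinite_of_asymptotics [IsTotallyReal K]
    (hS1 : ∀ (k : ℕ), 0 < k → ∀ (h : Fin k → 𝓞 K), Function.Injective h → ∀ (θ δ : ℝ), 0 < δ →
      0 < θ / 2 - δ → θ ≤ 1 / 2 → ∀ (G : (Fin k → ℝ) → ℝ), ContDiff ℝ 1 G → ∀ (v₀ : ℝ → 𝓞 K),
      (∀ N i, Ideal.span {v₀ N + h i} ⊔ paramW K N = ⊤) → S1Asymptotic K k h θ δ G v₀)
    (hS2 : ∀ (k : ℕ), 0 < k → ∀ (h : Fin k → 𝓞 K), Function.Injective h → ∀ (θ δ : ℝ), 0 < δ →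
      0 < θ / 2 - δ → θ ≤ 1 / 2 → PrimesHaveLevel K θ → PrimesAsymptotic K →
      ∀ (G : (Fin k → ℝ) → ℝ), ContDiff ℝ 1 G →
      ∀ (v₀ : ℝ → 𝓞 K), (∀ N i, Ideal.span {v₀ N + h i} ⊔ paramW K N = ⊤) →
      ∀ m, S2Asymptotic K k h θ δ G v₀ m)
    (hlevel : ∀ θ : ℝ, 0 < θ → θ < 1 / 2 → PrimesHaveLevel K θ)
    (hP : PrimesAsymptotic K)
    (H : Finset (𝓞 K)) (h105 : 105 ≤ H.card)
    (hadm : ∀ P : Ideal (𝓞 K), P.IsPrime → ∃ a : 𝓞 K, ∀ h ∈ H, a - h ∉ P) :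
    {α : 𝓞 K | ∃ h₁ ∈ H, ∃ h₂ ∈ H, h₁ ≠ h₂ ∧ Prime (α + h₁) ∧ Prime (α + h₂)}.Infinite := by
  refine CastilloEtAl2015.infinite_of_forall_card_eq (fun H' hcard hadm' => ?_) H h105 hadm
  -- enumerate `H'` by `Fin 105`
  set e : Fin 105 ≃ {x // x ∈ H'} := (Fin.castOrderIso hcard.symm).toEquiv.trans H'.equivFin.symm with he
  set h : Fin 105 → 𝓞 K := fun i => (e i).1 with hh
  have hinj : Function.Injective h := fun i j hij => e.injective (Subtype.ext hij)
  have hmem : ∀ i, h i ∈ H' := fun i => (e i).2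
  -- `M₁₀₅ > 4`, moved to a polynomial test function
  obtain ⟨F₀, hF₀, h4⟩ := exists_four_lt_maynardFunctional_holds
  obtain ⟨q, hq, hq4⟩ := MaynardL2.exists_polynomial_maynardFunctional_gt (n := 104) hF₀
    (by norm_num : (0 : ℝ) ≤ 4) h4
  set G : (Fin 105 → ℝ) → ℝ := fun x => MvPolynomial.eval x q with hG
  have hGdiff : ContDiff ℝ 1 G := (MaynardL2.contDiff_mvPolynomial_eval q).of_le le_top
  set F := (maynardSimplex 105).indicator G with hF
  have hI : 0 < maynardI 105 F := hq.maynardI_pos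
  have hMF : 4 < (∑ m, maynardJ 105 m F) / maynardI 105 F := hq4
  -- the numerology
  obtain ⟨θ, δ, hθ0, hθ, hδ, hη, hgt⟩ := exists_theta_delta hMF
  have hρ : (1 : ℝ) * maynardI 105 F < (θ / 2 - δ) * ∑ m, maynardJ 105 m F := by
    rw [one_mul]
    have := mul_lt_mul_of_pos_right hgt hI
    rwa [one_mul, mul_assoc, div_mul_cancel₀ _ hI.ne'] at this
  -- the classes `v₀(N)`
  obtain ⟨v₀, hv₀⟩ := exists_wTrick_fun hadm' hmem
  -- the two asymptotics and Corollary 2.6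
  have h1 := hS1 105 (by norm_num) h hinj θ δ hδ hη hθ.le G hGdiff v₀ hv₀
  have h2 := hS2 105 (by norm_num) h hinj θ δ hδ hη hθ.le (hlevel θ hθ0 hθ) hP G hGdiff v₀ hv₀
  have hinf := infinite_setOf_lt_card_of_asymptotics h1 h2 (tendsto_delta_of_primesAsymptotic hP)
    tendsto_cardA_atTop (eventually_nfMainTerm_pos 105 hη) hρ
  -- two primes
  refine hinf.mono fun α hα => ?_
  have hα' : (1 : ℝ) < ((((Finset.univ : Finset (Fin 105)).filter fun i => Prime (α + h i)).card : ℝ)) := hα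
  have h2le : 1 < ((Finset.univ : Finset (Fin 105)).filter fun i => Prime (α + h i)).card := by
    exact_mod_cast hα'
  obtain ⟨i, hi, j, hj, hij⟩ := Finset.one_lt_card.1 h2le
  rw [Finset.mem_filter] at hi hj
  exact ⟨h i, hmem i, h j, hmem j, fun heq => hij (hinj heq), hi.2, hj.2⟩

/-- **Theorem 1.1 of Castillo–Hall–Lemke Oliver–Pollack–Thompson for totally real fields, from
Hinz's Bombieri–Vinogradov theorem and Mitsui's prime number theorem**: if for every totally real
number field `K` the prime elements of `𝓞_K` have every level of distribution `θ < 1/2`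
(Theorem 2.7 = [Hinz 1988], the predicate `PrimesHaveLevel K θ`) and `|P(N)|` obeys Mitsui's
asymptotic (p. 11, the predicate `PrimesAsymptotic K`), then
`Literature.NumberTheory.Sieve.castilloEtAl2015_thm_1_1_totallyReal` holds: every admissible
`105`-set `H ⊆ 𝓞_K` has infinitely many translates `α + H` containing two primes. Everything else
(the Maynard–Tao sieve over `𝓞_K`: Proposition 2.1 via Lemmas 2.2–2.5 and Maynard's Lemmas
5.1–6.3 over ideals, Corollary 2.6, the numerics `M₁₀₅ > 4`) is PROVED in the `MaynardNF*` files.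
[cite: CastilloEtAl2015, Theorem 1.1, Proposition 2.1, Corollary 2.6, Theorem 2.7] -/
theorem castillo_of_hinz_mitsui
    (hHM : ∀ (K : Type) [Field K] [NumberField K] [IsTotallyReal K],
      (∀ θ : ℝ, 0 < θ → θ < 1 / 2 → PrimesHaveLevel K θ) ∧ PrimesAsymptotic K) :
    castilloEtAl2015_thm_1_1_totallyReal := by
  intro K _ _ _ H h105 hadm
  obtain ⟨hlevel, hP⟩ := hHM K
  exact twoPrimes_infinite_of_asymptotics
    (fun k hk h hinj θ δ hδ hη hθ G hG v₀ _ => S1_asymptotic hk hinj hδ hη hθ hG.continuous v₀)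
    (fun k hk h hinj θ δ hδ hη hθ hlev hP' G hG v₀ hv₀ m =>
      S2_asymptotic hk hinj hδ hη hθ hlev hP' hG.continuous v₀ hv₀ m)
    hlevel hP H h105 hadm

end Literature.NumberTheory.Sieve.MaynardNF
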